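import Literature.Barriers.CriticalPhenomena.LongRangeTrivialityOnZ3Proofs
import Mathlib.Analysis.SpecialFunctions.Trigonometric.Series

/-!
# `LongRangeTrivialityOnZ3` from Panis's Theorem 1.2 alone: the case `β_c = 0` is Gaussian by
# independence (infinite temperature)

Sibling of `Literature/Barriers/CriticalPhenomena/LongRangeTrivialityOnZ3.lean` (barrier catalogue
D-0021, sub-problem `Ising3DConformalLimit`) and of `LongRangeTrivialityOnZ3Proofs.lean`. The barrier
`LongRangeTrivialityOnZ3 : ∀ C₀ α, 0 < C₀ → 0 < α → α < 3/2 → ¬ HasNonGaussianSmearingZ3 (C₀|x-y|₁^{-3-α})`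
is proved in the barrier file from THREE named facts (`LongRangeTrivialityOnZ3.of_facts`):
Panis's Theorem 1.2 (`panis_thm12`), the variance footnote (`panis_variance_bound`, since discharged:
`panis_variance_bound_holds`) and `β_c > 0` (`panis_criticalBeta_pos`, Panis 2023 §1.2.1 citing
Fisher 1967 — undischarged; with the tree's definition `β_c = sInf {β > 0 | m*(β) > 0}` its proof needs
the spontaneous magnetisation of the free-boundary-plus-field state, i.e. uniqueness at `h ≠ 0`).

This file removes the third fact from the trust base:

**`LongRangeTrivialityOnZ3.of_thm12 (h12 : panis_thm12) : LongRangeTrivialityOnZ3`.**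

The point is that `β_c = LongRangeIsing.criticalBeta J ≥ 0` always (`criticalBeta_nonneg`), and the two
cases are settled separately:

* `β_c > 0`: Theorem 1.2 at `β = β_c` exactly as in `of_facts` (`not_hasNonGaussianSmearingZ3_of_thm12`),
  the variance footnote being the theorem `panis_variance_bound_holds`;
* `β_c = 0` (no transition recorded by the `sInf`, or `inf = 0`): then the smearings are evaluated at
  `β = 0`, where every Gibbs weight is `1` and the spins are INDEPENDENT FAIR SIGNS whatever `J`:
  `⟨∏_{x∈B} g_x(σ_x)⟩_{Λ,J,h,0} = ∏_{x∈B} (g_x(1)+g_x(-1))/2` (`expectIn_zero_prod`, `state_zero_prod`), so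
  `Σ_L(0) = |Λ_L|` (`blockVariance_zero`), `⟨exp(z T_{f,L,0})⟩_0 = ∏_{x∈Λ_{NL}} cosh(z f(x/L)|Λ_L|^{-1/2})`
  (`state_zero_exp_smeared`), `⟨T_{f,L,0}²⟩_0 = |Λ_L|⁻¹ ∑_x f(x/L)²` (`state_zero_smeared_sq`), and the
  elementary estimate `|∏ cosh cᵢ - e^{∑cᵢ²/2}| ≤ e^{∑cᵢ²/2} ∑ cᵢ⁴/4` (`abs_prod_cosh_sub_exp_sum_le`, from
  `cosh c ≤ e^{c²/2}`, `cosh c · e^{-c²/2} ≥ 1 - c⁴/4` and Weierstrass' product inequality) gives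
  `|⟨e^{zT}⟩_0 - e^{(z²/2)⟨T²⟩_0}| ≤ K_{f,z}/|Λ_L| → 0` (`tendsto_mgfDeviation_zero`, any `d ≥ 1`, `J ≥ 0`) —
  the central limit theorem for the triangular array `f(x/L)σ_x` in moment-generating-function form;
  hence `¬ HasNonGaussianSmearingZ3 J` whenever `criticalBeta J = 0`
  (`not_hasNonGaussianSmearingZ3_of_criticalBeta_eq_zero`).

So the formal barrier now rests on `panis_thm12` only (in fact on its instance `d = 3`, `β = β_c > 0`,
`α < 3/2`). What THAT still requires is Panis's proof of Theorem 1.2 = Theorem 5.5 + Remark 5.4 of the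
source, whose printed inputs are: Proposition 4.6 (deviation from Wick's law, [A, Prop. 12.1]) in the
form of the first display of the proof of Theorem 5.5; the tree diagram bound `|U₄| ≤ 2∑_u∏ᵢ⟨σ_uσ_{xᵢ}⟩` (§4.2, the display
following Proposition 4.7, after [A]); the sliding-scale infrared bound Theorem 3.18 [ADC]; the
Messager–Miracle-Solé inequalities Proposition 3.2 / Corollary 3.3 and `χ_L ≤ C L^{-d} Σ_L`; and the
infrared bound Proposition 3.8 with `1 - Ĵ(p) ≍ |p|^α` for the algebraic couplings
(`⟨σ₀σ_x⟩_{β} ≤ C/(β|x|^{d-α∧2})`, Remark 5.4) — random currents, reflection positivity and the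
spectral representation for general pair interactions; none of it is in the tree for long-range `J`.

## Contents

* `LongRangeIsing.one_sub_sum_le_prod` (Weierstrass), `one_sub_pow_four_le_cosh_mul_exp`,
  `abs_prod_cosh_sub_exp_sum_le` (pure real analysis).
* `LongRangeIsing.pairGibbsWeight_zero`, `expectIn_zero_eq`, `expectIn_zero_prod`, `state_zero_prod`,
  `state_zero_pair`, `state_zero_pair_eq_ite`, `blockVariance_zero` (independence at `β = 0`).
* `LongRangeIsing.smeared_eq_sum_div`, `state_zero_exp_smeared`, `state_zero_smeared_sq`,
  `tendsto_mgfDeviation_zero`.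
* `not_hasNonGaussianSmearingZ3_of_criticalBeta_eq_zero`, `not_hasNonGaussianSmearingZ3_of_thm12`,
  `LongRangeTrivialityOnZ3.of_thm12`, `not_interactionUniformZ3_of_thm12`.

## Mathlib / tree anchors

`Fintype.prod_sum`, `UnitsInt.univ`, `Fintype.card_fun`, `Fintype.card_units_int`, `Real.exp_sum`,
`Real.cosh_eq`, `Real.cosh_le_exp_half_sq`, `Real.hasSum_cosh` + `sum_le_hasSum` (`1 + x²/2 ≤ cosh x`),
`Real.one_sub_le_exp_neg`, `Finset.prod_le_one`, `Finset.induction_on`, `Filter.Tendsto.inv_tendsto_atTop`,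
`squeeze_zero'`; tree: `prod_inVol_of_subset`, `spinAt_glue_coe`, `card_box`, `box_nonempty`,
`exists_forall_subset_box`, and from `LongRangeTrivialityOnZ3Proofs`: `spinAt_mul_spinAt_eq_spinProduct`,
`state_pair_self`, `blockVariance_eq_sum`, `state_sum₂`, `smeared_sq_eq`, `exists_box_of_hasCompactSupport`,
`sum_box_mul_le_of_nonneg`, `criticalBeta_nonneg`, `algebraicCoupling_nonneg`, `panis_variance_bound_holds`,
`longRange_exponent_pos`.

## References

* R. Panis, arXiv:2309.05797 (2023) = Ann. Probab. 54 (2026): §1.2.1 (`β_c`, `Σ_L(β)`, `T_{f,L,β}`),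
  Theorem 1.2; for the outstanding inputs §3.2 Prop. 3.2/Cor. 3.3, §3.3 Prop. 3.8, §3.4 Thm. 3.18,
  §4.2 Props. 4.6–4.7, §5 Thm. 5.5 and Remark 5.4 [Panis2023Triviality] (held; read pp. 5–7, 13–16,
  19–22 of the arXiv version).
-/

noncomputable section

namespace Literature.Barriers.CriticalPhenomena

open Literature.Probability.LatticeModels Literature.Probability.Percolation Filter Topology Finset
open scoped symmDiff

namespace LongRangeIsing

variable {d : ℕ}

/-! ### An elementary product estimate: `|∏ cosh cᵢ - exp(∑ cᵢ²/2)| ≤ exp(∑ cᵢ²/2) ∑ cᵢ⁴/4` -/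

section Analytic

/-- Weierstrass' product inequality: for `0 ≤ rᵢ ≤ 1`, `1 - ∑ᵢ (1 - rᵢ) ≤ ∏ᵢ rᵢ`. [folklore] -/
theorem one_sub_sum_le_prod {ι : Type*} (s : Finset ι) (r : ι → ℝ) (h0 : ∀ i ∈ s, 0 ≤ r i)
    (h1 : ∀ i ∈ s, r i ≤ 1) : 1 - ∑ i ∈ s, (1 - r i) ≤ ∏ i ∈ s, r i := by
  classical
  induction s using Finset.induction_on with
  | empty => simp
  | insert a s ha ih =>
    rw [Finset.sum_insert ha, Finset.prod_insert ha]
    have hP0 : 0 ≤ ∏ i ∈ s, r i := Finset.prod_nonneg fun i hi => h0 i (Finset.mem_insert_of_mem hi)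
    have hP1 : ∏ i ∈ s, r i ≤ 1 := Finset.prod_le_one (fun i hi => h0 i (Finset.mem_insert_of_mem hi))
      fun i hi => h1 i (Finset.mem_insert_of_mem hi)
    have hih := ih (fun i hi => h0 i (Finset.mem_insert_of_mem hi)) fun i hi => h1 i (Finset.mem_insert_of_mem hi)
    have ha0 := h0 a (Finset.mem_insert_self a s)
    have ha1 := h1 a (Finset.mem_insert_self a s)
    nlinarith

/-- `1 - x⁴/4 ≤ cosh(x) exp(-x²/2)` (from `cosh x ≥ 1 + x²/2` and `e^{-v} ≥ 1 - v`). [folklore] -/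
theorem one_sub_pow_four_le_cosh_mul_exp (x : ℝ) :
    1 - x ^ 4 / 4 ≤ Real.cosh x * Real.exp (-(x ^ 2 / 2)) := by
  -- `1 + x²/2 ≤ cosh x` (first two terms of the power series)
  have hcosh : 1 + x ^ 2 / 2 ≤ Real.cosh x := by
    have h := Real.hasSum_cosh x
    have h2 : ∑ n ∈ Finset.range 2, x ^ (2 * n) / ((2 * n).factorial : ℝ) = 1 + x ^ 2 / 2 := by
      simp [Finset.sum_range_succ, Nat.factorial]
    rw [← h2]
    exact sum_le_hasSum _ (fun n _ => div_nonneg (by rw [pow_mul]; positivity) (by positivity)) h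
  have hexp : 1 - x ^ 2 / 2 ≤ Real.exp (-(x ^ 2 / 2)) := Real.one_sub_le_exp_neg _
  have hexp0 : 0 < Real.exp (-(x ^ 2 / 2)) := Real.exp_pos _
  calc 1 - x ^ 4 / 4 = (1 + x ^ 2 / 2) * (1 - x ^ 2 / 2) := by ring
    _ ≤ (1 + x ^ 2 / 2) * Real.exp (-(x ^ 2 / 2)) := mul_le_mul_of_nonneg_left hexp (by positivity)
    _ ≤ Real.cosh x * Real.exp (-(x ^ 2 / 2)) := mul_le_mul_of_nonneg_right hcosh hexp0.le

/-- **Product of hyperbolic cosines versus the Gaussian**: for reals `cᵢ`,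
`|∏ᵢ cosh cᵢ - exp(∑ᵢ cᵢ²/2)| ≤ exp(∑ᵢ cᵢ²/2) · ∑ᵢ cᵢ⁴/4` (`cosh c ≤ e^{c²/2}` and
`cosh c · e^{-c²/2} ≥ 1 - c⁴/4`, with Weierstrass' inequality). This is the moment generating
function of a sum of independent symmetric `±cᵢ` against that of the Gaussian with the same
variance. [folklore] -/
theorem abs_prod_cosh_sub_exp_sum_le {ι : Type*} (s : Finset ι) (c : ι → ℝ) :
    |∏ i ∈ s, Real.cosh (c i) - Real.exp (∑ i ∈ s, c i ^ 2 / 2)| ≤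
      Real.exp (∑ i ∈ s, c i ^ 2 / 2) * ∑ i ∈ s, c i ^ 4 / 4 := by
  set r : ι → ℝ := fun i => Real.cosh (c i) * Real.exp (-(c i ^ 2 / 2)) with hr
  have hr0 : ∀ i ∈ s, 0 ≤ r i := fun i _ =>
    mul_nonneg (zero_le_one.trans (Real.one_le_cosh _)) (Real.exp_pos _).le
  have hr1 : ∀ i ∈ s, r i ≤ 1 := by
    intro i _
    have h := Real.cosh_le_exp_half_sq (c i)
    have hpos : 0 < Real.exp (c i ^ 2 / 2) := Real.exp_pos _
    rw [hr]
    dsimp only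
    rw [Real.exp_neg, mul_inv_le_iff₀ hpos, one_mul]
    exact h
  have hE : 0 < Real.exp (∑ i ∈ s, c i ^ 2 / 2) := Real.exp_pos _
  -- `∏ cosh = exp(∑ c²/2) ∏ r`
  have hprod : ∏ i ∈ s, Real.cosh (c i) = Real.exp (∑ i ∈ s, c i ^ 2 / 2) * ∏ i ∈ s, r i := by
    rw [Real.exp_sum, ← Finset.prod_mul_distrib]
    refine Finset.prod_congr rfl fun i _ => ?_
    rw [hr]
    dsimp only
    rw [Real.exp_neg, mul_comm (Real.exp _), mul_assoc, inv_mul_cancel₀ (Real.exp_pos _).ne', mul_one]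
  have hP1 : ∏ i ∈ s, r i ≤ 1 := Finset.prod_le_one hr0 hr1
  have hW : 1 - ∑ i ∈ s, c i ^ 4 / 4 ≤ ∏ i ∈ s, r i := by
    refine le_trans ?_ (one_sub_sum_le_prod s r hr0 hr1)
    have : ∑ i ∈ s, (1 - r i) ≤ ∑ i ∈ s, c i ^ 4 / 4 :=
      Finset.sum_le_sum fun i _ => by linarith [one_sub_pow_four_le_cosh_mul_exp (c i)]
    linarith
  rw [hprod, abs_sub_comm, abs_of_nonneg (by nlinarith), ← mul_one_sub]
  exact mul_le_mul_of_nonneg_left (by linarith) hE.le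

end Analytic

/-! ### Infinite temperature: at `β = 0` the spins are independent fair signs -/

section InfiniteTemperature

variable (J : Site d → Site d → ℝ) (h : ℝ)

/-- At `β = 0` every Boltzmann weight equals `1`. [folklore] -/
theorem pairGibbsWeight_zero (Λ : Finset (Site d)) (τ : Λ → ℤˣ) : pairGibbsWeight J Λ 0 h τ = 1 := by
  simp [pairGibbsWeight]

/-- At `β = 0` the finite-volume Gibbs expectation is the uniform average over `{±1}^Λ`
(whatever `J` and `h`). [folklore] -/
theorem expectIn_zero_eq (Λ : Finset (Site d)) (F : SpinConfig (Site d) → ℝ) :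
    expectIn J Λ 0 h F = (∑ τ : Λ → ℤˣ, F (glue Λ τ .free)) / (Fintype.card (Λ → ℤˣ) : ℝ) := by
  simp only [expectIn, pairGibbsWeight_zero, mul_one, Finset.sum_const, Finset.card_univ, nsmul_eq_mul]

/-- **Independent fair spins at `β = 0`**: for `B ⊆ Λ` and any functions `g_x`,
`⟨∏_{x ∈ B} g_x(σ_x)⟩_{Λ,J,h,β=0} = ∏_{x ∈ B} (g_x(1) + g_x(-1))/2`. [folklore] -/
theorem expectIn_zero_prod {Λ B : Finset (Site d)} (hB : B ⊆ Λ) (g : Site d → ℝ → ℝ) :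
    expectIn J Λ 0 h (fun σ => ∏ x ∈ B, g x (spinAt x σ)) = ∏ x ∈ B, (g x 1 + g x (-1)) / 2 := by
  classical
  -- the integrand as a product over all the sites of `Λ`
  set G : ↥Λ → ℤˣ → ℝ := fun z u => if (z : Site d) ∈ B then g z ((u : ℤ) : ℝ) else 1 with hG
  have hF : ∀ τ : ↥Λ → ℤˣ, ∏ x ∈ B, g x (spinAt x (glue Λ τ .free)) = ∏ z : ↥Λ, G z (τ z) := by
    intro τ
    rw [← prod_inVol_of_subset hB (fun x => g x (spinAt x (glue Λ τ .free))), inVol, Finset.prod_filter]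
    refine Finset.prod_congr rfl fun z _ => ?_
    simp only [hG]
    split_ifs with hz
    · rw [spinAt_glue_coe]
      rfl
    · rfl
  have hnum : ∑ τ : ↥Λ → ℤˣ, ∏ x ∈ B, g x (spinAt x (glue Λ τ .free)) =
      ∏ z : ↥Λ, (if (z : Site d) ∈ B then g z 1 + g z (-1) else 2) := by
    simp_rw [hF]
    rw [← Fintype.prod_sum]
    refine Finset.prod_congr rfl fun z _ => ?_
    rw [UnitsInt.univ, Finset.sum_insert (by decide), Finset.sum_singleton]
    simp only [hG, Units.val_one, Int.cast_one, Units.val_neg, Int.cast_neg]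
    split_ifs
    · rfl
    · norm_num
  have hden : (Fintype.card (↥Λ → ℤˣ) : ℝ) = ∏ _z : ↥Λ, (2 : ℝ) := by
    rw [Fintype.card_fun, Fintype.card_units_int, Finset.prod_const, Finset.card_univ]
    push_cast
    rfl
  rw [expectIn_zero_eq, hnum, hden, ← Finset.prod_div_distrib]
  rw [← prod_inVol_of_subset hB (fun x => (g x 1 + g x (-1)) / 2), inVol, Finset.prod_filter]
  refine Finset.prod_congr rfl fun z _ => ?_
  split_ifs
  · rfl
  · norm_num

/-- At `β = 0` the infinite-volume state of a product observable `∏_{x ∈ B} g_x(σ_x)` is the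
product of the single-spin averages (the box expectations are eventually constant). [folklore] -/
theorem state_zero_prod (B : Finset (Site d)) (g : Site d → ℝ → ℝ) :
    state J 0 h (fun σ => ∏ x ∈ B, g x (spinAt x σ)) = ∏ x ∈ B, (g x 1 + g x (-1)) / 2 := by
  obtain ⟨L₀, hL₀⟩ := exists_forall_subset_box d B
  refine Tendsto.limUnder_eq (tendsto_const_nhds.congr' ?_)
  filter_upwards [eventually_ge_atTop L₀] with L hL
  exact (expectIn_zero_prod J h (hL₀ L hL) g).symm

/-- At `β = 0` distinct spins are uncorrelated: `⟨σ_x σ_y⟩_{J,h,0} = 0` for `x ≠ y`. [folklore] -/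
theorem state_zero_pair {x y : Site d} (hxy : x ≠ y) : state J 0 h (spinProduct ({x} ∆ {y})) = 0 := by
  classical
  have hobs : (spinProduct ({x} ∆ {y}) : SpinConfig (Site d) → ℝ) =
      fun σ => ∏ w ∈ ({x, y} : Finset (Site d)), (fun _ s => s) w (spinAt w σ) := by
    funext σ
    rw [← spinAt_mul_spinAt_eq_spinProduct, Finset.prod_pair hxy]
  rw [hobs, state_zero_prod J h {x, y} (fun _ s => s), Finset.prod_pair hxy]
  norm_num

/-- At `β = 0` the two-point function is the identity kernel. [folklore] -/
theorem state_zero_pair_eq_ite (x y : Site d) :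
    state J 0 0 (spinProduct ({x} ∆ {y})) = if x = y then 1 else 0 := by
  split_ifs with hxy
  · rw [hxy, state_pair_self]
  · exact state_zero_pair J 0 hxy

/-- `Σ_L(0) = |Λ_L|`: at `β = 0` the block spin has the variance of `|Λ_L|` independent signs.
[folklore] -/
theorem blockVariance_zero (hJ : ∀ x y, 0 ≤ J x y) (L : ℕ) : blockVariance J 0 L = #(box d L) := by
  rw [blockVariance_eq_sum J 0 le_rfl hJ L]
  simp_rw [state_zero_pair_eq_ite J]
  have h1 : ∀ x ∈ box d L, (∑ y ∈ box d L, if x = y then (1 : ℝ) else 0) = 1 := fun x hx => by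
    rw [Finset.sum_ite_eq, if_pos hx]
  rw [Finset.sum_congr rfl h1, Finset.sum_const, nsmul_eq_mul, mul_one]

end InfiniteTemperature


/-! ### The smeared observables at `β = 0`: a triangular array of independent signs -/

section InfiniteTemperatureSmearing

variable (J : Site d → Site d → ℝ)

/-- The smeared observable is a finite sum: `T_{f,L,β}(σ) = Σ_L(β)^{-1/2} ∑_{x ∈ Λ_{NL}} f(x/L) σ_x`
when `f(x/L) = 0` off `Λ_{NL}`. [cite: Panis2023Triviality, §1.2.1 (T_{f,L,β})] -/
theorem smeared_eq_sum_div (β : ℝ) (f : EuclideanSpace ℝ (Fin d) → ℝ) {N L : ℕ}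
    (hsupp : ∀ x : Site d, f ((L : ℝ)⁻¹ • siteVec x) ≠ 0 → x ∈ box d (N * L)) (σ : SpinConfig (Site d)) :
    smeared J β L f σ =
      (∑ x ∈ box d (N * L), f ((L : ℝ)⁻¹ • siteVec x) * spinAt x σ) / Real.sqrt (blockVariance J β L) := by
  rw [smeared]
  congr 1
  apply finsum_eq_sum_of_support_subset
  intro x hx
  rw [Function.mem_support] at hx
  exact Finset.mem_coe.2 (hsupp x fun h0 => hx (by rw [h0, zero_mul]))

/-- **At `β = 0` the moment generating function of `T_{f,L,0}` is a product of hyperbolic cosines**: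
`⟨exp(z T_{f,L,0})⟩_0 = ∏_{x ∈ Λ_{NL}} cosh(z f(x/L) |Λ_L|^{-1/2})` (independent fair signs,
`Σ_L(0) = |Λ_L|`). [folklore] -/
theorem state_zero_exp_smeared (hJ : ∀ x y, 0 ≤ J x y) (f : EuclideanSpace ℝ (Fin d) → ℝ) {N L : ℕ}
    (hsupp : ∀ x : Site d, f ((L : ℝ)⁻¹ • siteVec x) ≠ 0 → x ∈ box d (N * L)) (z : ℝ) :
    state J 0 0 (fun σ => Real.exp (z * smeared J 0 L f σ)) =
      ∏ x ∈ box d (N * L), Real.cosh (z * f ((L : ℝ)⁻¹ • siteVec x) / Real.sqrt (#(box d L) : ℝ)) := by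
  set c : Site d → ℝ := fun x => z * f ((L : ℝ)⁻¹ • siteVec x) / Real.sqrt (#(box d L) : ℝ) with hc
  have hobs : (fun σ => Real.exp (z * smeared J 0 L f σ)) =
      fun σ => ∏ x ∈ box d (N * L), (fun x s => Real.exp (c x * s)) x (spinAt x σ) := by
    funext σ
    rw [smeared_eq_sum_div J 0 f hsupp σ, blockVariance_zero J hJ L, mul_div_assoc', Finset.mul_sum,
      Finset.sum_div, ← Real.exp_sum]
    congr 1
    refine Finset.sum_congr rfl fun x _ => ?_
    simp only [hc]
    ring
  rw [hobs, state_zero_prod J 0 (box d (N * L)) (fun x s => Real.exp (c x * s))]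
  refine Finset.prod_congr rfl fun x _ => ?_
  rw [Real.cosh_eq, mul_one, mul_neg_one]

/-- **At `β = 0` the smeared variance is `⟨T_{f,L,0}²⟩_0 = |Λ_L|⁻¹ ∑_{x ∈ Λ_{NL}} f(x/L)²`.**
[folklore] -/
theorem state_zero_smeared_sq (hJ : ∀ x y, 0 ≤ J x y) (f : EuclideanSpace ℝ (Fin d) → ℝ) {N L : ℕ}
    (hsupp : ∀ x : Site d, f ((L : ℝ)⁻¹ • siteVec x) ≠ 0 → x ∈ box d (N * L)) :
    state J 0 0 (fun σ => smeared J 0 L f σ ^ 2) =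
      ∑ x ∈ box d (N * L), f ((L : ℝ)⁻¹ • siteVec x) ^ 2 / (#(box d L) : ℝ) := by
  classical
  have hV : blockVariance J 0 L = #(box d L) := blockVariance_zero J hJ L
  have hV0 : 0 ≤ blockVariance J 0 L := by rw [hV]; positivity
  have hobs : (fun σ => smeared J 0 L f σ ^ 2) = fun σ => ∑ x ∈ box d (N * L), ∑ y ∈ box d (N * L),
      (f ((L : ℝ)⁻¹ • siteVec x) * f ((L : ℝ)⁻¹ • siteVec y) / blockVariance J 0 L) *
        spinProduct ({x} ∆ {y}) σ :=
    funext fun σ => smeared_sq_eq J 0 f hsupp hV0 σ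
  rw [hobs, state_sum₂ J 0 le_rfl hJ (box d (N * L)) (box d (N * L)) (fun x => x) (fun y => y) _]
  simp_rw [state_zero_pair_eq_ite J, mul_ite, mul_one, mul_zero]
  refine Finset.sum_congr rfl fun x hx => ?_
  rw [Finset.sum_ite_eq, if_pos hx, hV, sq]

/-- **Gaussianity at infinite temperature** (the central limit theorem for the triangular array of
independent fair signs `f(x/L)σ_x`, in moment-generating-function form): for `d ≥ 1`, `J ≥ 0`,
`f ∈ C_c(ℝ^d)` and `z ∈ ℝ`,
`|⟨exp(z T_{f,L,0})⟩_0 - exp((z²/2)⟨T_{f,L,0}²⟩_0)| ≤ K_{f,z} / |Λ_L| → 0` as `L → ∞`.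
(`J ≥ 0` is only used to identify `Σ_L(0)` through the tree's monotone box limit.) [folklore] -/
theorem tendsto_mgfDeviation_zero (hd : 1 ≤ d) (hJ : ∀ x y, 0 ≤ J x y)
    (f : EuclideanSpace ℝ (Fin d) → ℝ) (hf : Continuous f) (hfs : HasCompactSupport f) (z : ℝ) :
    Tendsto (fun L : ℕ => mgfDeviation J 0 L f z) atTop (𝓝 0) := by
  obtain ⟨N, _, hsupp⟩ := exists_box_of_hasCompactSupport f hfs
  obtain ⟨M, hM⟩ := hf.bounded_above_of_compact_support hfs
  set K : ℝ := Real.exp ((#(box d N) : ℝ) * (z ^ 2 * M ^ 2 / 2)) *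
    ((#(box d N) : ℝ) * (z ^ 4 * M ^ 4 / 4)) with hK
  -- the bound `K / |Λ_L|` for `L ≥ 1`
  have hmaj : ∀ L : ℕ, 1 ≤ L → mgfDeviation J 0 L f z ≤ K * ((#(box d L) : ℝ))⁻¹ := by
    intro L hL
    set V : ℝ := (#(box d L) : ℝ) with hVdef
    set B : Finset (Site d) := box d (N * L) with hB
    set c : Site d → ℝ := fun x => z * f ((L : ℝ)⁻¹ • siteVec x) / Real.sqrt V with hc
    have hV1 : 1 ≤ V := by
      rw [hVdef]
      exact_mod_cast (box_nonempty d L).card_pos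
    have hV0 : 0 < V := by linarith
    -- the deviation at `β = 0` in closed form
    have h1 : state J 0 0 (fun σ => Real.exp (z * smeared J 0 L f σ)) = ∏ x ∈ B, Real.cosh (c x) :=
      state_zero_exp_smeared J hJ f (hsupp L hL) z
    have h2 : z ^ 2 / 2 * state J 0 0 (fun σ => smeared J 0 L f σ ^ 2) = ∑ x ∈ B, c x ^ 2 / 2 := by
      rw [state_zero_smeared_sq J hJ f (hsupp L hL), Finset.mul_sum]
      refine Finset.sum_congr rfl fun x _ => ?_
      simp only [hc]
      rw [div_pow, mul_pow, Real.sq_sqrt hV0.le]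
      ring
    have hdev : mgfDeviation J 0 L f z =
        |∏ x ∈ B, Real.cosh (c x) - Real.exp (∑ x ∈ B, c x ^ 2 / 2)| := by
      rw [mgfDeviation, h1, h2]
    -- sizes
    have hfx : ∀ x : Site d, f ((L : ℝ)⁻¹ • siteVec x) ^ 2 ≤ M ^ 2 := by
      intro x
      have h := hM ((L : ℝ)⁻¹ • siteVec x)
      rw [Real.norm_eq_abs] at h
      rw [← sq_abs]
      exact pow_le_pow_left₀ (abs_nonneg _) h 2
    have hc2 : ∀ x : Site d, c x ^ 2 ≤ z ^ 2 * M ^ 2 / V := by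
      intro x
      simp only [hc]
      rw [div_pow, mul_pow, Real.sq_sqrt hV0.le]
      exact div_le_div_of_nonneg_right (mul_le_mul_of_nonneg_left (hfx x) (sq_nonneg z)) hV0.le
    have hc4 : ∀ x : Site d, c x ^ 4 ≤ z ^ 4 * M ^ 4 / V ^ 2 := by
      intro x
      have h := pow_le_pow_left₀ (sq_nonneg (c x)) (hc2 x) 2
      calc c x ^ 4 = (c x ^ 2) ^ 2 := by ring
        _ ≤ (z ^ 2 * M ^ 2 / V) ^ 2 := h
        _ = z ^ 4 * M ^ 4 / V ^ 2 := by ring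
    have hcardB : (#B : ℝ) ≤ (#(box d N) : ℝ) * V := by
      have h := sum_box_mul_le_of_nonneg (d := d) N L (fun _ => (1 : ℝ)) fun _ => zero_le_one
      simpa [Finset.sum_const, nsmul_eq_mul] using h
    have hS2 : ∑ x ∈ B, c x ^ 2 / 2 ≤ (#(box d N) : ℝ) * (z ^ 2 * M ^ 2 / 2) := by
      calc ∑ x ∈ B, c x ^ 2 / 2 ≤ ∑ _x ∈ B, z ^ 2 * M ^ 2 / V / 2 :=
            Finset.sum_le_sum fun x _ => by linarith [hc2 x]
        _ = (#B : ℝ) * (z ^ 2 * M ^ 2 / V / 2) := by rw [Finset.sum_const, nsmul_eq_mul]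
        _ ≤ (#(box d N) : ℝ) * V * (z ^ 2 * M ^ 2 / V / 2) :=
            mul_le_mul_of_nonneg_right hcardB (by positivity)
        _ = (#(box d N) : ℝ) * (z ^ 2 * M ^ 2 / 2) := by field_simp
    have hS4 : ∑ x ∈ B, c x ^ 4 / 4 ≤ (#(box d N) : ℝ) * (z ^ 4 * M ^ 4 / 4) * V⁻¹ := by
      calc ∑ x ∈ B, c x ^ 4 / 4 ≤ ∑ _x ∈ B, z ^ 4 * M ^ 4 / V ^ 2 / 4 :=
            Finset.sum_le_sum fun x _ => by linarith [hc4 x]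
        _ = (#B : ℝ) * (z ^ 4 * M ^ 4 / V ^ 2 / 4) := by rw [Finset.sum_const, nsmul_eq_mul]
        _ ≤ (#(box d N) : ℝ) * V * (z ^ 4 * M ^ 4 / V ^ 2 / 4) :=
            mul_le_mul_of_nonneg_right hcardB (by positivity)
        _ = (#(box d N) : ℝ) * (z ^ 4 * M ^ 4 / 4) * V⁻¹ := by field_simp
    calc mgfDeviation J 0 L f z
        ≤ Real.exp (∑ x ∈ B, c x ^ 2 / 2) * ∑ x ∈ B, c x ^ 4 / 4 := by
          rw [hdev]
          exact abs_prod_cosh_sub_exp_sum_le B c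
      _ ≤ Real.exp ((#(box d N) : ℝ) * (z ^ 2 * M ^ 2 / 2)) *
            ((#(box d N) : ℝ) * (z ^ 4 * M ^ 4 / 4) * V⁻¹) :=
          mul_le_mul (Real.exp_le_exp.2 hS2) hS4 (Finset.sum_nonneg fun x _ => by positivity)
            (Real.exp_pos _).le
      _ = K * V⁻¹ := by rw [hK]; ring
  -- `|Λ_L| = (2L+1)^d → ∞`
  have hbox : Tendsto (fun L : ℕ => (#(box d L) : ℝ)) atTop atTop := by
    have h1 : Tendsto (fun L : ℕ => (2 * L + 1) ^ d) atTop atTop := by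
      refine Filter.tendsto_atTop_mono (fun L => ?_) tendsto_id
      calc id L ≤ 2 * L + 1 := by simp; omega
        _ = (2 * L + 1) ^ 1 := (pow_one _).symm
        _ ≤ (2 * L + 1) ^ d := Nat.pow_le_pow_right (by omega) hd
    simp only [card_box]
    exact tendsto_natCast_atTop_atTop.comp h1
  have hlim : Tendsto (fun L : ℕ => K * ((#(box d L) : ℝ))⁻¹) atTop (𝓝 0) := by
    simpa using hbox.inv_tendsto_atTop.const_mul K
  refine squeeze_zero' (Eventually.of_forall fun L => abs_nonneg _) ?_ hlim
  exact eventually_atTop.2 ⟨1, hmaj⟩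

end InfiniteTemperatureSmearing

end LongRangeIsing

open LongRangeIsing

/-! ### The barrier from Theorem 1.2 alone -/

/-- **If `β_c = 0` the critical smearings are Gaussian** (independent fair signs): for `J ≥ 0` on
`ℤ³` with `criticalBeta J = 0` — no transition recorded by `sInf`, or a transition at every
`β > 0` — `¬ HasNonGaussianSmearingZ3 J`. This is the case the named fact `panis_criticalBeta_pos`
was used to exclude in `LongRangeTrivialityOnZ3.of_facts`; it is settled here directly instead.
[folklore] -/
theorem not_hasNonGaussianSmearingZ3_of_criticalBeta_eq_zero {J : Site 3 → Site 3 → ℝ}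
    (hJ : ∀ x y, 0 ≤ J x y) (h0 : LongRangeIsing.criticalBeta J = 0) : ¬ HasNonGaussianSmearingZ3 J := by
  rintro ⟨f, hf, hfs, z, hnot⟩
  apply hnot
  rw [h0]
  exact tendsto_mgfDeviation_zero J (by norm_num) hJ f hf hfs z

/-- **Theorem 1.2 at `β_c > 0` gives Gaussian critical smearings on `ℤ³` for `α < 3/2`** (the
argument of `LongRangeTrivialityOnZ3.of_facts`, with the variance footnote now the theorem
`panis_variance_bound_holds` and `β_c > 0` an explicit hypothesis): the printed bound is
`≤ exp((z²/2)C_{|f|}) · C(β_c⁻⁴ ∨ β_c⁻²) z⁴ / L^{3-2α} → 0`. [cite: Panis2023Triviality, Theorem 1.2] -/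
theorem not_hasNonGaussianSmearingZ3_of_thm12 (h12 : panis_thm12) {C₀ α : ℝ} (hC₀ : 0 < C₀)
    (hα : 0 < α) (hα' : α < 3 / 2)
    (hβc : 0 < LongRangeIsing.criticalBeta (algebraicCoupling 3 C₀ α)) :
    ¬ HasNonGaussianSmearingZ3 (algebraicCoupling 3 C₀ α) := by
  rintro ⟨f, hf, hfs, z, hnot⟩
  apply hnot
  set J := algebraicCoupling 3 C₀ α with hJ
  have hexp := longRange_exponent_pos hα'
  obtain ⟨C, hC, hbound⟩ := h12 3 (by norm_num) C₀ α hC₀ hα hexp f hf hfs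
  have hfa : Continuous fun x => |f x| := hf.abs
  have hfas : HasCompactSupport fun x => |f x| := hfs.norm
  obtain ⟨Cf, hCf⟩ := panis_variance_bound_holds 3 (by norm_num) C₀ α hC₀ hα (fun x => |f x|) hfa hfas
  set K : ℝ := Real.exp (z ^ 2 / 2 * Cf) *
    (C * max (LongRangeIsing.criticalBeta J ^ (-(4 : ℝ))) (LongRangeIsing.criticalBeta J ^ (-(2 : ℝ))) * z ^ 4)
    with hK
  have hmaj : ∀ L : ℕ, 1 ≤ L →
      mgfDeviation J (LongRangeIsing.criticalBeta J) L f z ≤ K * ((L : ℝ) ^ (((3 : ℕ) : ℝ) - 2 * min α 2))⁻¹ := by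
    intro L hL
    have h1 := hbound (LongRangeIsing.criticalBeta J) hβc le_rfl L hL z
    have hCz : 0 ≤ C * max (LongRangeIsing.criticalBeta J ^ (-(4 : ℝ)))
        (LongRangeIsing.criticalBeta J ^ (-(2 : ℝ))) * z ^ 4 := by
      have : 0 ≤ max (LongRangeIsing.criticalBeta J ^ (-(4 : ℝ))) (LongRangeIsing.criticalBeta J ^ (-(2 : ℝ))) :=
        le_max_of_le_left (Real.rpow_nonneg hβc.le _)
      positivity
    have hLpos : 0 < (L : ℝ) ^ (((3 : ℕ) : ℝ) - 2 * min α 2) := Real.rpow_pos_of_pos (by exact_mod_cast hL) _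
    have h2 : Real.exp (z ^ 2 / 2 * state J (LongRangeIsing.criticalBeta J) 0
          (fun σ => smeared J (LongRangeIsing.criticalBeta J) L (fun x => |f x|) σ ^ 2)) ≤
        Real.exp (z ^ 2 / 2 * Cf) := by
      apply Real.exp_le_exp.2
      exact mul_le_mul_of_nonneg_left (hCf L hL) (by positivity)
    calc mgfDeviation J (LongRangeIsing.criticalBeta J) L f z
        ≤ Real.exp (z ^ 2 / 2 * state J (LongRangeIsing.criticalBeta J) 0
            (fun σ => smeared J (LongRangeIsing.criticalBeta J) L (fun x => |f x|) σ ^ 2)) *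
            (C * max (LongRangeIsing.criticalBeta J ^ (-(4 : ℝ))) (LongRangeIsing.criticalBeta J ^ (-(2 : ℝ))) * z ^ 4 /
              (L : ℝ) ^ (((3 : ℕ) : ℝ) - 2 * min α 2)) := h1
      _ ≤ Real.exp (z ^ 2 / 2 * Cf) *
            (C * max (LongRangeIsing.criticalBeta J ^ (-(4 : ℝ))) (LongRangeIsing.criticalBeta J ^ (-(2 : ℝ))) * z ^ 4 /
              (L : ℝ) ^ (((3 : ℕ) : ℝ) - 2 * min α 2)) :=
          mul_le_mul_of_nonneg_right h2 (div_nonneg hCz hLpos.le)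
      _ = K * ((L : ℝ) ^ (((3 : ℕ) : ℝ) - 2 * min α 2))⁻¹ := by rw [hK]; ring
  have hlim : Tendsto (fun L : ℕ => K * ((L : ℝ) ^ (((3 : ℕ) : ℝ) - 2 * min α 2))⁻¹) atTop (𝓝 0) := by
    have h1 : Tendsto (fun L : ℕ => ((L : ℝ) ^ (((3 : ℕ) : ℝ) - 2 * min α 2))⁻¹) atTop (𝓝 0) :=
      ((tendsto_rpow_atTop hexp).comp tendsto_natCast_atTop_atTop).inv_tendsto_atTop
    simpa using h1.const_mul K
  refine squeeze_zero' (Eventually.of_forall fun L => abs_nonneg _) ?_ hlim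
  exact eventually_atTop.2 ⟨1, hmaj⟩

/-- **The barrier `LongRangeTrivialityOnZ3` holds granted Panis's Theorem 1.2 alone** (of the three
named facts behind `LongRangeTrivialityOnZ3.of_facts`, the variance footnote is the theorem
`panis_variance_bound_holds` and `β_c > 0` is bypassed: `β_c ≥ 0`, and at `β_c = 0` the spins are
independent fair signs whose smearings are Gaussian by `tendsto_mgfDeviation_zero`).
[cite: Panis2023Triviality, Theorem 1.2] -/
theorem LongRangeTrivialityOnZ3.of_thm12 (h12 : panis_thm12) : LongRangeTrivialityOnZ3 := by
  intro C₀ α hC₀ hα hα'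
  rcases (criticalBeta_nonneg (algebraicCoupling 3 C₀ α)).eq_or_lt with h0 | hpos
  · exact not_hasNonGaussianSmearingZ3_of_criticalBeta_eq_zero (algebraicCoupling_nonneg hC₀.le α) h0.symm
  · exact not_hasNonGaussianSmearingZ3_of_thm12 h12 hC₀ hα hα' hpos

/-- The interaction-uniformity no-go, granted Theorem 1.2 alone. [cite: Panis2023Triviality, Theorem 1.2] -/
theorem not_interactionUniformZ3_of_thm12 (h12 : panis_thm12) :
    ¬ InteractionUniformZ3 fun m => HasNonGaussianSmearingZ3 m.coupling :=
  (LongRangeTrivialityOnZ3.of_thm12 h12).not_interactionUniformZ3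

end Literature.Barriers.CriticalPhenomena

end
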